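import Summits.QuantumFields.YangMills.Theorems.BalabanUVNodesN07SplitClauseHeadKnitMeetNormalisedTower
import Summits.QuantumFields.YangMills.Theorems.BalabanUVNodesK0HalvingStepOfCoreGuardedChain
import HarnessLib

/-!
# N07 [B11] (= [15] = [Balaban1985Variational]) Sect. F, S6 HEAD — THE MEET KNIT UNDER PRINT's NORMALISED LANDAU GAUGE, TOWER EDITION, **PART 2: THE GUARDED [15] PROP. 8 STEP TOKEN**
# (the sibling `…HeadKnitMeetNormalisedTower` composed with k0-s1-w3's guarded chain closer; split off for the line budget)

Cell `pub-ymgap`, seat `pub-ymgap-dag-n07-e` g25 (FAN-OUT §N07 row s3; LANE OWNER of the K0 road), MODULE 67c part 2 (INTENT-67c, cell bus; plan g90 ruling (P1)(ii)).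
`--kind proof --supports stmt-QuantumFields-20541 --as helper` (K0⁷); count-neutral; def-free.  [15] = [Balaban1985Variational]; [6] = [Balaban1985RegularSpaces]; [I] = [Balaban1987RG1].

WHAT IS PROVED (sorry-free; no definition; axioms standard).  ★★★ `prop8RegSepTopStepG_of_normalisedGauge_of_chartMeetTower F N`: `Prop8RegSepTopStepG F N suppDom Adm B₃ a₀ a₁` for EVERY guard
`Adm` implying the V20-G conjuncts and the run's grid numerics and EVERY normalisation predicate `Nrm`, modulo the sibling's displayed HS3NORM-67c (print's normalised Landau gauge at every meeting,
print-margin-clean datum WITH [15] (152) on the whole (1.131) tower: (T1) the gauge equation `U^{u} = e^{iη_jA}` on `□₀`, (T2) the level-weighted letters `‖A b‖ < κ·ε_j·L^{j−j′}` on every `□_{j′}`,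
`j′ ≤ j`; the print-box letters; (153) for the meet; `Nrm`) and HCHART-MEET-NORM-67c (print's (154)–(159) GIVEN (T1)∕(T2)), HLETTERS-NORM ∕ HBUDGET-NORM and the κ-generic smallness letters — by
`prop8RegSepTopStepG_of_datumGaugeSplitCoreG` (k0-s1-w3).  MODULE 67b (p670002) is the print-margin edition without the tower rows; this edition's HS3NORM is STRONGER and its HCHART-MEET-NORM WEAKER
(two more premises) — same conclusion; it is the edition the S3 door SPEC D90-S3W1 S1 and the chart's free FAR rows (`B c := Q_c(A)`) are keyed to (located memo (F3)).
HONEST SCOPE.  Count-neutral by-name composition; every hypothesis DISPLAYED, none discharged; joint satisfiability at the record NOT claimed; `Nrm` abstract (text of record MODULE 60″ at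
instantiation); NO stub registered or closed; nothing of [15]∕[6] ANALYSIS asserted; K0⁷ ∕ K1⁹ NOT closed; N07 ∕ N05 NOT discharged; counts unmoved (typed 28∕28 · discharged 7∕28); one finite 𝕋⁴
programme at fixed ε — the route closes the conditional finite-𝕋⁴ rung `BalabanLadder.UV` ONLY; the YM mass gap (Clay) is NOT proved by any of this; nothing continuum ∕ ℝ⁴ ∕ OS.  No `sorry`, no
`def`, no `instance`, no `notation`.

References: [15] (144) p. 300, (150)–(153) p. 301, (162)–(168) pp. 303–304, Prop. 8 p. 304; [6] Thm. 2 p. 83, (1.29) p. 81, p. 98, Prop. 6 (1.135)–(1.138) p. 99, (1.131) p. 99, (1.3)–(1.9)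
p. 77; [I] (0.1) p. 251.
-/

set_option autoImplicit false

noncomputable section
open scoped BigOperators Matrix.Norms.L2Operator

namespace Summit.QuantumFields.YangMills.BalabanUVNodes.N07SplitClauseHeadKnitMeetNormalisedTowerStep

open Literature.MathematicalPhysics.QuantumFieldTheory.Balaban1983to89
open Literature.MathematicalPhysics.QuantumFieldTheory.Balaban1983to89.Node00
open Literature.MathematicalPhysics.QuantumFieldTheory.Balaban1983to89.B15DeterminingSets
open Literature.MathematicalPhysics.QuantumFieldTheory.Balaban1983to89.B12RegularSpaces111 (gaugeU expI grad)
open B15Eq112TorusCover (cover)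
open B14DomainGeom (Pt Within)
open B14.Eq213MaximalDomains (side cubeExt)
open B5Eq117TorusCarriers (Mk)
open B5Eq118OneStroke (iterBlockOf)
open B5Prop12FieldsLattice (distSite)
open B8Eq131Cubes (sqLo sqHi box cube)
open B8LeafModelZd (ZdIdx)
open B11Eq115Space (levOf)
open B6SectADomainsV1 (Domains)
open B6SectAOperatorsV1 (BondIdx RE dsE QpE)
open Literature.MathematicalPhysics.QuantumFieldTheory.BalabanImbrieJaffe1984to88.BIJ85AxialPropagator411 (BondSpace)
open T4Continuum (T4Family)
open T4AxialGaugeSmallField (castSite)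
open B16Sect1Backgrounds (toMS)
open GaugeField (gaugeAct)
open MatrixLog (mlog)
open Summit.QuantumFields.YangMills.Theorems.K0FlatCubeOpsTextP (flatH)
open Summit.QuantumFields.YangMills.BalabanUVNodes.N07HalvingStepTopOfLocalLetters (Letters10On)
open Summit.QuantumFields.YangMills.BalabanUVNodes.N07LocalLettersSplitCore (LocalGaugeSplitOn)
open Summit.QuantumFields.YangMills.BalabanUVNodes.N07LocalLettersCoreGuarded (DatumGaugeSplitTopStepCoreG)
open Summit.QuantumFields.YangMills.BalabanUVNodes.N07SplitClauseHeadKnitMeetNormalisedTower (datumGaugeSplitTopStepCoreG_of_normalisedGauge_of_chartMeetTower)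
open Summit.QuantumFields.YangMills.Theorems.K0HalvingStepOfCoreGuardedChain (prop8RegSepTopStepG_of_datumGaugeSplitCoreG)

open scoped Classical in
/-- ★★★ **THE GUARDED [15] PROP. 8 STEP TOKEN FROM THE NORMALISED MEET KNIT, TOWER EDITION** — the sibling's knit ∘ k0-s1-w3's `prop8RegSepTopStepG_of_datumGaugeSplitCoreG` (`2L² ≤ B₃`, `4C ≤ B₃`,
`16θ ≤ 1`, `(16Q + 1024κ²)a₀ ≤ 1`, `32κa₀ ≤ 1`, κ a FREE letter): `Prop8RegSepTopStepG F N suppDom Adm B₃ a₀ a₁` for EVERY guard `Adm` implying the V20-G conjuncts and the run's grid numerics,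
modulo HS3NORM-67c (print's normalised [6] Thm. 2 at every meeting, print-margin-clean datum, WITH (152) on the whole tower: (T1) gauge equation on `□₀`, (T2) level-weighted letters on every
`□_{j′}`), HCHART-MEET-NORM-67c (print's (154)–(159) given (T1)∕(T2)), HLETTERS-NORM ∕ HBUDGET-NORM and the smallness letters (all displayed); no stub registered or closed here.
[cite: Balaban1985Variational, Prop. 8 p.304, (150)–(153) p.301, (162)–(168) pp.303–304; Balaban1985RegularSpaces, Thm. 2 p.83, (1.29) p.81, p.98 (□̃, □_j), Prop. 6 (1.135)–(1.138) p.99, (1.131) p.99, (1.3)–(1.9) p.77; Balaban1987RG1, (0.1) p.251] -/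
theorem prop8RegSepTopStepG_of_normalisedGauge_of_chartMeetTower (F : T4Family) (N : ℕ) [NeZero N] :
    ∃ (Mh₀ R₀ : ℕ) (CH δH BH : ℝ), 0 ≤ CH ∧ 0 < δH ∧ 0 < BH ∧
    ∀ {ρ : ℕ}
      -- structural letters: grid cube `Mc`, block height `a′` (`M_h = L^{a′} ≥ M_h⁰`), `R ≥ R₀`, the collar `ρ` with `L·M_h ∣ ρ`, `R·L·M_h ≤ ρ`, `L ≤ ρ`
      {Mc Mh R a' : ℕ} (_ : 1 ≤ Mc) (_ : Mc ≤ ρ) (_ : Mh = F.L ^ a') (_ : Mh₀ ≤ Mh) (_ : R₀ ≤ R) (_ : F.L * Mh ∣ ρ) (_ : R * (F.L * Mh) ≤ ρ) (hLρ : F.L ≤ ρ)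
      -- the two constants of the plan's V20-G guard `c ≤ ν.M₁ ∧ k + c₀ ≤ F.m + K` and their side conditions (as in FILE D)
      {c c₀ : ℕ} (_ : (11 * 4 + 4 * ρ + Mc + 3) * F.L ≤ c) (_ : Mc + 11 * 4 + 6 * ρ ≤ 2 * F.L ^ c₀) (_ : F.m ≤ c₀) (_ : a' + 3 ≤ c₀)
      -- ★ THE GUARD: any step guard implying the V20-G conjuncts AND the run's grid numerics the meet's (2.1) needs (`hgran`, `hdiv`)
      (Adm : StepGuard F) (_ : ∀ (ν : Stage7Numerics) (M : ℕ) (g : ℕ → ℝ) (K k : ℕ) (s : SeqOfRecord F ν M g K k), Adm ν M g K k s → c ≤ ν.M₁ ∧ k + c₀ ≤ F.m + K)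
      (_ : ∀ (ν : Stage7Numerics) (M : ℕ) (g : ℕ → ℝ) (K k : ℕ) (s : SeqOfRecord F ν M g K k), Adm ν M g K k s → ∀ j : ℕ, 1 ≤ j → j ≤ k →
        F.L * Mh ∣ M * RkOfRecord (F.P K).L ν.r (g j) ∧ dCubeSide (F.P K).L M (RkOfRecord (F.P K).L ν.r (g j)) j ∣ (F.P K).sitesPerDir 0)
      -- the token's letters, `0 < B₃`, the FREE (152)-letter `κ ≥ 0`, the (163)-type letter `θ_H` of the `H` doors
      {B₃ C θ Q κ a₀ a₁ θH : ℝ} (_ : 0 < B₃) (_ : 0 ≤ C) (_ : 0 ≤ θ) (_ : 0 ≤ Q) (_ : 0 ≤ κ) (_ : 8 * CH * BH * Real.exp (-(δH * (ρ : ℝ))) ≤ θH)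
      -- V19's floor `2L² ≤ B₃` and the (162)–(166♭) smallness letters of the closers, κ-generic
      (_ : 2 * (F.L : ℝ) ^ 2 ≤ B₃) (_ : 4 * C ≤ B₃) (_ : 16 * θ ≤ 1) (_ : (16 * Q + 1024 * κ ^ 2) * a₀ ≤ 1) (_ : 32 * κ * a₀ ≤ 1)
      -- the chart side's PER-LEVEL SIZE LETTERS — NO shear letters
      (β₁ β₂ s' t₁ : (ℕ → ℝ) → (ℕ → ℝ) → ℕ → ℝ)
      -- ★ HLETTERS-NORM (RANGED): signs only
      (_ : ∀ (ε δ : ℕ → ℝ) (j : ℕ), 0 < δ j → δ j ≤ a₁ → B₃ * δ j ≤ ε j → ε j ≤ a₀ → 0 ≤ β₁ ε δ j ∧ 0 ≤ β₂ ε δ j ∧ 0 ≤ s' ε δ j)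
      -- ★ HBUDGET-NORM (RANGED): no `t_D`, no `C_S·B_S`
      (_ : ∀ (K : ℕ) (ε δ : ℕ → ℝ) (j : ℕ), 0 < δ j → δ j ≤ a₁ → B₃ * δ j ≤ ε j → ε j ≤ a₀ → ∃ t₂ t₃ : ℝ,
        1 / 4 * ((sideP (F.P K) Mc ρ : ℕ) : ℝ) * max (4 * CH * BH * β₁ ε δ j) (θH * β₂ ε δ j) < t₂ ∧ 2 * CH * BH * s' ε δ j < t₃ ∧
        t₁ ε δ j + t₂ + t₃ < C * δ j + θ * ε j + Q * ε j ^ 2)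
      -- ★ THE NORMALISATION PREDICATE (abstract)
      (Nrm : ∀ (ν : Stage7Numerics) (M : ℕ) (g : ℕ → ℝ) (K k : ℕ), SeqOfRecord F ν M g K k → GaugeField (F.P K) 0 (SU N) → ℕ → Pt (F.P K).d →
        GaugeTransf (F.P K) 0 (SU N) → (PBond (F.P K) 0 → MatA N) → Prop)
      -- ★ HS3NORM-67c (tower rows (T1)∕(T2))
      (_ : ∀ (ν : Stage7Numerics) (M : ℕ) (g : ℕ → ℝ) (K k : ℕ) (s : SeqOfRecord F ν M g K k), Sect2.SeqSeparated ν.M₁ s → 0 < ν.M₁ →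
        Adm ν M g K k s → 1 ≤ k →
        ∀ (ε δ : ℕ → ℝ),
        (∀ n, n ≤ k → 0 < δ n ∧ δ n ≤ a₁) → (∀ n, n < k → δ n ≤ 2 * δ (n + 1)) → (∀ n, n < k → δ (n + 1) ≤ 2 * δ n) →
        (∀ n, n ≤ k → B₃ * δ n ≤ ε n ∧ ε n ≤ a₀) → (∀ n, n < k → ε n ≤ 2 * ε (n + 1)) → (∀ n, n < k → ε (n + 1) ≤ 2 * ε n) →
        ∀ W : MSField (F.P K) (SU N), Sect2.DataSmall7PTop (avOfRecord F N K) s.Ω (suppDomOfRecord F ν K s.Ω) k δ W →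
        ∀ U : GaugeField (F.P K) 0 (SU N),
        (∀ n, n ≤ k → PlaqSmallOn (Sect2.omegaPlaqsTop s.Ω (suppDomOfRecord F ν K s.Ω) n) (ε n * (F.P K).eta n ^ 2) U) →
        (∀ n, n ≤ k → Sect2.CoDivSmallOn (Sect2.omegaBondsTop s.Ω (suppDomOfRecord F ν K s.Ω) n) (ε n * (F.P K).eta n ^ 3) U) →
        AgreeOn (genSet s.Ω k) (avgFamily (avOfRecord F N K) U) W → IsCritOnFibre F N K (genSet s.Ω k) W U →
        ∀ (n : ℕ) (hk : K - n ≤ (F.P K).m + (F.P K).K), 1 ≤ K - n → K - n ≤ k → ∀ (idx : Pt (F.P K).d),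
        (∃ x ∈ box (F.P K).L (cornerP (F.P K) Mc ρ idx) (sideP (F.P K) Mc ρ) (K - n), ∃ y : Pt (F.P K).d, cover (F.P K) y ∈ s.Ω (K - n) ∧ Within ((3 : ℕ) : ℤ) x y) →
        (K - n = k ∨ ∀ z ∈ box (F.P K).L (cornerP (F.P K) Mc ρ idx - ((2 * ρ : ℕ) : Pt (F.P K).d)) (sideP (F.P K) Mc ρ + 2 * (2 * ρ)) (K - n),
          cover (F.P K) z ∉ s.Ω (K - n + 1)) →
        ∃ (u : GaugeTransf (F.P K) 0 (SU N)) (A : PBond (F.P K) 0 → MatA N),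
        (∀ b ∈ (Sect2.regionOfSet (F.P K) (cover (F.P K) '' box (F.P K).L (cornerP (F.P K) Mc ρ idx) (sideP (F.P K) Mc ρ) (K - n))).bonds,
          gaugeU (fun x => ιSU N (u x)) (fun b' => ιSU N (U b')) b = expI ((F.P K).eta (K - n)) (A b)) ∧
        -- (T1) the gauge equation on the WHOLE TOWER `□₀` of the datum ([6] p. 98, (1.131))
        (∀ b ∈ (Sect2.regionOfSet (F.P K) (cover (F.P K) '' cube (F.P K).L (cornerP (F.P K) Mc ρ idx) (sideP (F.P K) Mc ρ) ρ (K - n) 0)).bonds,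
          gaugeU (fun x => ιSU N (u x)) (fun b' => ιSU N (U b')) b = expI ((F.P K).eta (K - n)) (A b)) ∧
        -- (T2) (152)'s LEVEL-WEIGHTED letters on every `□_{j′}`, `j′ ≤ K − n`
        (∀ j', j' ≤ K - n →
          ∀ b ∈ (Sect2.regionOfSet (F.P K) (cover (F.P K) '' cube (F.P K).L (cornerP (F.P K) Mc ρ idx) (sideP (F.P K) Mc ρ) ρ (K - n) j')).bonds,
            ‖A b‖ < κ * ε (K - n) * ((F.P K).L : ℝ) ^ (K - n - j')) ∧
        (∀ b ∈ (Sect2.regionOfSet (F.P K) (cover (F.P K) '' box (F.P K).L (cornerP (F.P K) Mc ρ idx) (sideP (F.P K) Mc ρ) (K - n))).bonds,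
          ‖A b‖ < κ * ε (K - n)) ∧
        (∀ q ∈ (Sect2.regionOfSet (F.P K) (cover (F.P K) '' box (F.P K).L (cornerP (F.P K) Mc ρ idx) (sideP (F.P K) Mc ρ) (K - n))).dpairs,
          ‖grad ((F.P K).eta (K - n)) q.2.1 (fun y => A ⟨y, q.2.2⟩) q.1‖ < κ * ε (K - n)) ∧
        (∀ b ∈ Sect2.bondsDeep (cover (F.P K) '' box (F.P K).L (cornerP (F.P K) Mc ρ idx) (sideP (F.P K) Mc ρ) (K - n)),
          ‖Sect2.codiffCurlA ((F.P K).eta (K - n)) A b.src b.dir‖ < κ * ε (K - n)) ∧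
        (∀ b ∈ Sect2.bondsDeep (cover (F.P K) '' box (F.P K).L (cornerP (F.P K) Mc ρ idx) (sideP (F.P K) Mc ρ) (K - n)),
          ‖∑ ν' : Fin (F.P K).d, (((F.P K).eta (K - n) : ℝ) : ℂ)⁻¹ •
              (grad ((F.P K).eta (K - n)) ν' (fun y => A ⟨y, b.dir⟩) (b.src.unshift ν') - grad ((F.P K).eta (K - n)) ν' (fun y => A ⟨y, b.dir⟩) b.src)‖ <
            κ * ε (K - n)) ∧
        (∀ D' : Domains (F.P K), LinearMap.ker (QpE D') ≤
            LinearMap.ker (QpE (domainsMeet (cubeDomains (F.P K) (cornerP (F.P K) Mc ρ idx) (sideP (F.P K) Mc ρ) ρ (K - n) hk) (domainsOfSeq s.Ω (K - n) hk))) →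
          ∀ φ : MatA N →L[ℂ] ℂ,
          RE D' ((F.P K).eta (K - n))⁻¹ (dsE ((F.P K).eta (K - n))⁻¹ (WithLp.toLp 2 fun b => (φ (A b)).re : BondSpace (F.P K))) = 0 ∧
          RE D' ((F.P K).eta (K - n))⁻¹ (dsE ((F.P K).eta (K - n))⁻¹ (WithLp.toLp 2 fun b => (φ (A b)).im : BondSpace (F.P K))) = 0) ∧
        Nrm ν M g K k s U (K - n) idx u A)
      -- ★ HCHART-MEET-NORM-67c (tower rows (T1)∕(T2) as premises)
      (_ : ∀ (ν : Stage7Numerics) (M : ℕ) (g : ℕ → ℝ) (K k : ℕ) (s : SeqOfRecord F ν M g K k), Sect2.SeqSeparated ν.M₁ s → 0 < ν.M₁ →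
        Adm ν M g K k s → 1 ≤ k →
        ∀ (ε δ : ℕ → ℝ),
        (∀ n, n ≤ k → 0 < δ n ∧ δ n ≤ a₁) → (∀ n, n < k → δ n ≤ 2 * δ (n + 1)) → (∀ n, n < k → δ (n + 1) ≤ 2 * δ n) →
        (∀ n, n ≤ k → B₃ * δ n ≤ ε n ∧ ε n ≤ a₀) → (∀ n, n < k → ε n ≤ 2 * ε (n + 1)) → (∀ n, n < k → ε (n + 1) ≤ 2 * ε n) →
        ∀ W : MSField (F.P K) (SU N), Sect2.DataSmall7PTop (avOfRecord F N K) s.Ω (suppDomOfRecord F ν K s.Ω) k δ W →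
        ∀ U : GaugeField (F.P K) 0 (SU N),
        (∀ n, n ≤ k → PlaqSmallOn (Sect2.omegaPlaqsTop s.Ω (suppDomOfRecord F ν K s.Ω) n) (ε n * (F.P K).eta n ^ 2) U) →
        (∀ n, n ≤ k → Sect2.CoDivSmallOn (Sect2.omegaBondsTop s.Ω (suppDomOfRecord F ν K s.Ω) n) (ε n * (F.P K).eta n ^ 3) U) →
        AgreeOn (genSet s.Ω k) (avgFamily (avOfRecord F N K) U) W → IsCritOnFibre F N K (genSet s.Ω k) W U →
        ∀ (n : ℕ) (hk : K - n ≤ (F.P K).m + (F.P K).K), 1 ≤ K - n → K - n ≤ k → ∀ (idx : Pt (F.P K).d),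
        (∃ x ∈ box (F.P K).L (cornerP (F.P K) Mc ρ idx) (sideP (F.P K) Mc ρ) (K - n), ∃ y : Pt (F.P K).d, cover (F.P K) y ∈ s.Ω (K - n) ∧ Within ((3 : ℕ) : ℤ) x y) →
        (K - n = k ∨ ∀ z ∈ box (F.P K).L (cornerP (F.P K) Mc ρ idx - ((2 * ρ : ℕ) : Pt (F.P K).d)) (sideP (F.P K) Mc ρ + 2 * (2 * ρ)) (K - n),
          cover (F.P K) z ∉ s.Ω (K - n + 1)) →
        ∀ {HVd : Domains (F.P K)}
          (_ : HVd = domainsMeet (cubeDomains (F.P K) (cornerP (F.P K) Mc ρ idx) (sideP (F.P K) Mc ρ) ρ (K - n) hk) (domainsOfSeq s.Ω (K - n) hk))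
          (lo hi : ℕ → Pt (F.P K).d),
        lo 0 = (fun i => ((F.P K).L : ℤ) * (sqLo (F.P K).L (cornerP (F.P K) Mc ρ idx) ρ (K - n) 1 i - 1)) →
        hi 0 = (fun i => ((F.P K).L : ℤ) * (sqHi (F.P K).L (cornerP (F.P K) Mc ρ idx) (sideP (F.P K) Mc ρ) ρ (K - n) 1 i + 1) + (((F.P K).L : ℤ) - 1)) →
        (∀ j', 1 ≤ j' → lo j' = sqLo (F.P K).L (cornerP (F.P K) Mc ρ idx) ρ (K - n) j' - 1) →
        (∀ j', 1 ≤ j' → hi j' = sqHi (F.P K).L (cornerP (F.P K) Mc ρ idx) (sideP (F.P K) Mc ρ) ρ (K - n) j' + 1) →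
        ∃ HV : (BondIdx HVd → MatA N) →ₗ[ℂ] (PBond (F.P K) 0 → MatA N),
          (∀ (Bf : BondIdx HVd → MatA N) (b : PBond (F.P K) 0), HV Bf b = ∑ c, ((flatH (F.P K) (K - n) HVd (Pi.single c 1) b : ℝ) : ℂ) • Bf c) ∧
        ∀ (u : GaugeTransf (F.P K) 0 (SU N)) (A : PBond (F.P K) 0 → MatA N),
        (∀ b ∈ (Sect2.regionOfSet (F.P K) (cover (F.P K) '' box (F.P K).L (cornerP (F.P K) Mc ρ idx) (sideP (F.P K) Mc ρ) (K - n))).bonds,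
          gaugeU (fun x => ιSU N (u x)) (fun b' => ιSU N (U b')) b = expI ((F.P K).eta (K - n)) (A b)) →
        -- (T1) the gauge equation on the WHOLE TOWER `□₀` of the datum
        (∀ b ∈ (Sect2.regionOfSet (F.P K) (cover (F.P K) '' cube (F.P K).L (cornerP (F.P K) Mc ρ idx) (sideP (F.P K) Mc ρ) ρ (K - n) 0)).bonds,
          gaugeU (fun x => ιSU N (u x)) (fun b' => ιSU N (U b')) b = expI ((F.P K).eta (K - n)) (A b)) →
        -- (T2) (152)'s LEVEL-WEIGHTED letters on every `□_{j′}`, `j′ ≤ K − n`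
        (∀ j', j' ≤ K - n →
          ∀ b ∈ (Sect2.regionOfSet (F.P K) (cover (F.P K) '' cube (F.P K).L (cornerP (F.P K) Mc ρ idx) (sideP (F.P K) Mc ρ) ρ (K - n) j')).bonds,
            ‖A b‖ < κ * ε (K - n) * ((F.P K).L : ℝ) ^ (K - n - j')) →
        (∀ b ∈ (Sect2.regionOfSet (F.P K) (cover (F.P K) '' box (F.P K).L (cornerP (F.P K) Mc ρ idx) (sideP (F.P K) Mc ρ) (K - n))).bonds,
          ‖A b‖ < κ * ε (K - n)) →
        (∀ q ∈ (Sect2.regionOfSet (F.P K) (cover (F.P K) '' box (F.P K).L (cornerP (F.P K) Mc ρ idx) (sideP (F.P K) Mc ρ) (K - n))).dpairs,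
          ‖grad ((F.P K).eta (K - n)) q.2.1 (fun y => A ⟨y, q.2.2⟩) q.1‖ < κ * ε (K - n)) →
        (∀ b ∈ Sect2.bondsDeep (cover (F.P K) '' box (F.P K).L (cornerP (F.P K) Mc ρ idx) (sideP (F.P K) Mc ρ) (K - n)),
          ‖Sect2.codiffCurlA ((F.P K).eta (K - n)) A b.src b.dir‖ < κ * ε (K - n)) →
        (∀ b ∈ Sect2.bondsDeep (cover (F.P K) '' box (F.P K).L (cornerP (F.P K) Mc ρ idx) (sideP (F.P K) Mc ρ) (K - n)),
          ‖∑ ν' : Fin (F.P K).d, (((F.P K).eta (K - n) : ℝ) : ℂ)⁻¹ •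
              (grad ((F.P K).eta (K - n)) ν' (fun y => A ⟨y, b.dir⟩) (b.src.unshift ν') - grad ((F.P K).eta (K - n)) ν' (fun y => A ⟨y, b.dir⟩) b.src)‖ <
            κ * ε (K - n)) →
        (∀ D' : Domains (F.P K), LinearMap.ker (QpE D') ≤ LinearMap.ker (QpE HVd) → ∀ φ : MatA N →L[ℂ] ℂ,
          RE D' ((F.P K).eta (K - n))⁻¹ (dsE ((F.P K).eta (K - n))⁻¹ (WithLp.toLp 2 fun b => (φ (A b)).re : BondSpace (F.P K))) = 0 ∧
          RE D' ((F.P K).eta (K - n))⁻¹ (dsE ((F.P K).eta (K - n))⁻¹ (WithLp.toLp 2 fun b => (φ (A b)).im : BondSpace (F.P K))) = 0) →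
        Nrm ν M g K k s U (K - n) idx u A →
        ∃ (xc : Pt (F.P K).d) (B B' : BondIdx HVd → MatA N) (A₁ : PBond (F.P K) 0 → MatA N),
          xc ∈ box (F.P K).L (cornerP (F.P K) Mc ρ idx) (sideP (F.P K) Mc ρ) (K - n) ∧
          (∀ c : BondIdx HVd, ((c.1.1 : ℕ) = K - n ∨ blockOf c.1.2.src ∈ (cubeDomains (F.P K) (cornerP (F.P K) Mc ρ idx) (sideP (F.P K) Mc ρ) ρ (K - n) hk).Om ((c.1.1 : ℕ) + 1)) →
            ‖B c‖ ≤ β₁ ε δ (K - n) * (distSite (Mk (F.P K) (c.1.1 : ℕ)) c.1.2.src (iterBlockOf (c.1.1 : ℕ) (cover (F.P K) xc)) + 1)) ∧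
          (∀ c : BondIdx HVd, ¬ ((c.1.1 : ℕ) = K - n ∨ blockOf c.1.2.src ∈ (cubeDomains (F.P K) (cornerP (F.P K) Mc ρ idx) (sideP (F.P K) Mc ρ) ρ (K - n) hk).Om ((c.1.1 : ℕ) + 1)) →
            ‖B c‖ ≤ β₂ ε δ (K - n) * ((ρ : ℝ) + ((sideP (F.P K) Mc ρ : ℕ) : ℝ))) ∧
          (∀ c, ‖B' c‖ ≤ s' ε δ (K - n)) ∧
          Letters10On (cover (F.P K) '' box (F.P K).L (cornerP (F.P K) Mc ρ idx) (sideP (F.P K) Mc ρ) (K - n)) ((F.P K).eta (K - n)) (t₁ ε δ (K - n)) A₁ ∧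
          (∀ b, A b = A₁ b + HV B b - HV B' b)),
      Prop8RegSepTopStepG F N (fun ν K Ω => suppDomOfRecord F ν K Ω) Adm B₃ a₀ a₁ := by
  obtain ⟨Mh₀, R₀, CH, δH, BH, hCH, hδH, hBH, hmain⟩ := datumGaugeSplitTopStepCoreG_of_normalisedGauge_of_chartMeetTower F N
  refine ⟨Mh₀, R₀, CH, δH, BH, hCH, hδH, hBH, ?_⟩
  intro ρ Mc Mh R a' hMc hMcρ hMha hMh hR hdvd hRρ hLρ c c₀ hc hc₀ hmc₀ hac₀ Adm hAdm₁ hAdm₂ B₃ C θ Q κ a₀ a₁ θH hB₃ hC0 hθ0 hQ0 hκ0 h163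
    hB₃L hC hθ ha hκa β₁ β₂ s' t₁ hletters hbudget Nrm hS3 hchart
  exact prop8RegSepTopStepG_of_datumGaugeSplitCoreG hMc hLρ
    (hmain hMc hMcρ hMha hMh hR hdvd hRρ hLρ hc hc₀ hmc₀ hac₀ Adm hAdm₁ hAdm₂ hB₃ hC0 hθ0 hQ0 hκ0 h163 β₁ β₂ s' t₁ hletters hbudget Nrm hS3 hchart)
    hB₃L hC hθ hQ0 hκ0 ha hκa

end Summit.QuantumFields.YangMills.BalabanUVNodes.N07SplitClauseHeadKnitMeetNormalisedTowerStep

end
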